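import Literature.Algebra.EuclideanLattices.CosetGaussianMass
import Literature.MathematicalPhysics.StatisticalMechanics.BarlowStackingEnergy
import Summits.AtomisticToContinuum.Crystallization.Theses.HcpThetaUniversality
import Summits.AtomisticToContinuum.Crystallization.Theorems.PricedLinkCensusStackingHingeSitewiseEvenAlignmentDomination

/-!
# Route HcpThetaUniversality — `BarlowThetaDominance` (stmt-AtomisticToContinuum-5060)

For every Gaussian parameter `t > 0`, every Hägg word `s` and every layer `m`, the Gaussian site
energy of the Barlow stacking `barlowStacking 1 √(2/3) s` at layer `m` is at most that of hcp (the
alternating word `ABAB…`) at layer `0`: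
`barlowSiteEnergy (r ↦ e^{-t r²}) 1 √(2/3) s m ≤ barlowSiteEnergy (r ↦ e^{-t r²}) 1 √(2/3) alternatingHagg 0`.
We prove it for every in-layer spacing `a ≠ 0` and layer spacing `h ≠ 0`
(`barlowSiteEnergy_gauss_le_alternating`) and specialise.

Proof.
1. Layer sums factor (`layerInteraction_gauss`): the layer normal is orthogonal to the layers, so
   the Gaussian interaction of a site with a full layer at signed distance `k` and letter offset
   `δ` is `Φ_δ(k) = e^{-t (k h)²} Φ_δ(0)`.
2. Sign (`layerInteraction_one_zero_le`): `Φ_N(0) ≤ Φ_A(0)` — a triangular layer has larger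
   Gaussian mass seen from a lattice point than from a hole. This is Banaszczyk's coset inequality,
   in the tree as `Literature.Algebra.EuclideanLattices.tsum_exp_neg_mul_norm_zsmul_add_zsmul_sub_sq_le`.
   Hence `J_k = barlowCoupling = e^{-t (k h)²} (Φ_A(0) − Φ_N(0)) ≥ 0` is non-increasing in `k`.
3. Monotone pairing (`tsum_ite_le_tsum_ite_even`): in a Hägg word the ranges `k`, `k + 1` are
   never both aligned (forward: `PricedHcpWindowsSitewise.not_haggAligned_succ` of the tree;
   backward: `not_haggAligned_sub_succ`), so pairing the ranges `(2j, 2j+1)` gives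
   `∑_{k ≥ 2 aligned} J_k ≤ ∑_{k ≥ 2 even} J_k`, the hcp value.
4. `barlowSiteEnergy_eq` (`BarlowStackingEnergy.lean`) writes the site energy as
   `e₀ + ½ (forward + backward)`; the two pairings conclude.

References: W. Banaszczyk, Math. Ann. 296 (1993), Lemma 1.1; L. Bétermin, M. Petrache, J. Math.
Phys. 58 (2017) 071902, arXiv:1607.08716, Prop. 3.4 and Thm 1.1 Step 2.3 (the pairing, there on the
minimisation side); L. B. Pártay, C. Ortner et al., PCCP 19 (2017), App. A (Hägg words).
-/

noncomputable section

namespace Summit.AtomisticToContinuum.Crystallization.Theorems.BarlowTheta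

open Finset
open Literature.MathematicalPhysics.StatisticalMechanics
open Summit.AtomisticToContinuum.Crystallization.Theorems.PricedHcpWindowsSitewise
  (not_haggAligned_succ)

/-! ## Monotone pairing -/

/-- **Monotone pairing.** If the predicate `P` never holds at two consecutive ranges `k`, `k + 1`
(`k ≥ 2`) and the couplings `J ≥ 0` are non-increasing and summable, then
`∑'_{k ≥ 2, P k} J_k ≤ ∑'_{k ≥ 2, k even} J_k`: pair the ranges `(2j, 2j+1)`; at most one of each
pair satisfies `P`, and its coupling is at most `J_{2j}`. -/
theorem tsum_ite_le_tsum_ite_even {P : ℕ → Prop} [DecidablePred P] {J : ℕ → ℝ}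
    (hP : ∀ k, 2 ≤ k → P k → ¬ P (k + 1)) (hJ0 : ∀ k, 0 ≤ J k)
    (hmono : ∀ k, J (k + 1) ≤ J k) (hJ : Summable J) :
    ∑' k : ℕ, (if 2 ≤ k ∧ P k then J k else 0) ≤
      ∑' k : ℕ, (if 2 ≤ k ∧ Even k then J k else 0) := by
  set f : ℕ → ℝ := fun k => if 2 ≤ k ∧ P k then J k else 0 with hf
  set g : ℕ → ℝ := fun k => if 2 ≤ k ∧ Even k then J k else 0 with hg
  have hf0 : ∀ k, 0 ≤ f k := fun k => by
    simp only [hf]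
    split_ifs
    · exact hJ0 k
    · exact le_rfl
  have hg0 : ∀ k, 0 ≤ g k := fun k => by
    simp only [hg]
    split_ifs
    · exact hJ0 k
    · exact le_rfl
  have hfJ : ∀ k, f k ≤ J k := fun k => by
    simp only [hf]
    split_ifs
    · exact le_rfl
    · exact hJ0 k
  have hgJ : ∀ k, g k ≤ J k := fun k => by
    simp only [hg]
    split_ifs
    · exact le_rfl
    · exact hJ0 k
  -- `J` is antitone
  have hanti : ∀ k n : ℕ, k ≤ n → J n ≤ J k := by
    intro k n hkn
    induction n, hkn using Nat.le_induction with
    | base => exact le_rfl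
    | succ n _ ih => exact (hmono n).trans ih
  have hfe : Summable fun k => f (2 * k) :=
    hJ.of_nonneg_of_le (fun k => hf0 _) fun k => (hfJ _).trans (hanti k (2 * k) (by omega))
  have hfo : Summable fun k => f (2 * k + 1) :=
    hJ.of_nonneg_of_le (fun k => hf0 _) fun k => (hfJ _).trans (hanti k (2 * k + 1) (by omega))
  have hge : Summable fun k => g (2 * k) :=
    hJ.of_nonneg_of_le (fun k => hg0 _) fun k => (hgJ _).trans (hanti k (2 * k) (by omega))
  have hgo : Summable fun k => g (2 * k + 1) :=
    hJ.of_nonneg_of_le (fun k => hg0 _) fun k => (hgJ _).trans (hanti k (2 * k + 1) (by omega))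
  rw [← tsum_even_add_odd hfe hfo, ← tsum_even_add_odd hge hgo, ← hfe.tsum_add hfo,
    ← hge.tsum_add hgo]
  refine (hfe.add hfo).tsum_le_tsum (fun k => ?_) (hge.add hgo)
  -- the pair `(2k, 2k+1)`
  have hodd : ¬ Even (2 * k + 1) := Nat.not_even_iff_odd.2 ⟨k, rfl⟩
  have hg1 : g (2 * k + 1) = 0 := by simp only [hg, hodd, and_false, if_false]
  rw [hg1, add_zero]
  rcases Nat.eq_zero_or_pos k with rfl | hk
  · simp [hf, hg]
  · have h2 : 2 ≤ 2 * k := by omega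
    have hg2 : g (2 * k) = J (2 * k) := by
      simp only [hg, h2, true_and, even_two_mul k, if_true]
    rw [hg2]
    by_cases hPk : P (2 * k)
    · have hPk1 : ¬ P (2 * k + 1) := hP _ h2 hPk
      simp only [hf, h2, hPk, and_self, if_true, hPk1, and_false, if_false, add_zero, le_refl]
    · have hf1 : f (2 * k) = 0 := by simp only [hf, hPk, and_false, if_false]
      rw [hf1, zero_add]
      simp only [hf]
      split_ifs
      · exact hmono _
      · exact hJ0 _

/-! ## Hard core of the alignment sets -/

/-- Backward window recursion: the window from `m - (k+1)` of length `k + 1` is the window from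
`m - k` of length `k` plus the first letter `s (m - (k+1))`. -/
theorem haggWindow_sub_succ (s : ℤ → ℤ) (m : ℤ) (k : ℕ) :
    haggWindow s (m - (k + 1 : ℕ)) (k + 1) = haggWindow s (m - k) k + s (m - (k + 1 : ℕ)) := by
  rw [haggWindow, haggWindow, sum_range_succ']
  congr 1
  · refine sum_congr rfl fun i _ => ?_
    congr 1
    push_cast
    ring
  · congr 1
    push_cast
    ring

/-- Backward hard core: in a Hägg word the layers `m - k` and `m - (k+1)` are never both aligned
with layer `m`. -/
theorem not_haggAligned_sub_succ {s : ℤ → ℤ} (hs : IsHaggSeq s) (m : ℤ) (k : ℕ)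
    (h : HaggAligned s (m - k) k) : ¬ HaggAligned s (m - (k + 1 : ℕ)) (k + 1) := by
  simp only [HaggAligned] at h ⊢
  rw [haggWindow_sub_succ]
  rcases hs (m - (k + 1 : ℕ)) with h1 | h1 <;> rw [h1] <;> omega

/-! ## Gaussian layer sums -/

/-- **Factorisation of the Gaussian layer sums**: the layer normal is orthogonal to the layers, so
`Φ_δ(k) = e^{-t (k h)²} · Φ_δ(0)` for the Gaussian `r ↦ e^{-t r²}`. -/
theorem layerInteraction_gauss (t a h : ℝ) (δ k : ℤ) :
    layerInteraction (fun r => Real.exp (-t * r ^ 2)) a h δ k =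
      Real.exp (-t * ((k : ℝ) * h) ^ 2) *
        layerInteraction (fun r => Real.exp (-t * r ^ 2)) a h δ 0 := by
  unfold layerInteraction
  rw [← tsum_mul_left]
  refine tsum_congr fun ij => ?_
  dsimp only
  rw [norm_layerVec, norm_layerVec, Real.sq_sqrt (by positivity), Real.sq_sqrt (by positivity),
    ← Real.exp_add]
  congr 1
  push_cast
  ring

/-- The interlayer Gaussian coupling: `J_k = e^{-t (k h)²} (Φ_A(0) − Φ_N(0))`. -/
theorem barlowCoupling_gauss (t a h : ℝ) (k : ℕ) :
    barlowCoupling (fun r => Real.exp (-t * r ^ 2)) a h k =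
      Real.exp (-t * ((k : ℝ) * h) ^ 2) *
        (layerInteraction (fun r => Real.exp (-t * r ^ 2)) a h 0 0 -
          layerInteraction (fun r => Real.exp (-t * r ^ 2)) a h 1 0) := by
  unfold barlowCoupling
  rw [layerInteraction_gauss t a h 0 k, layerInteraction_gauss t a h 1 k, Int.cast_natCast, mul_sub]

/-- The two generators `u = (a, 0, 0)`, `v = (a/2, a√3/2, 0)` of the triangular layer are linearly
independent (`a ≠ 0`). -/
theorem linearIndependent_triangularVec {a : ℝ} (ha : a ≠ 0) :
    LinearIndependent ℝ ![triangularVec₁ a, triangularVec₂ a] := by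
  refine LinearIndependent.pair_iff.2 fun p q hpq => ?_
  have e1 := congrArg (fun x : EuclideanSpace ℝ (Fin 3) => x 1) hpq
  have e0 := congrArg (fun x : EuclideanSpace ℝ (Fin 3) => x 0) hpq
  simp only [PiLp.add_apply, PiLp.smul_apply, PiLp.zero_apply, triangularVec₁, triangularVec₂,
    smul_eq_mul] at e0 e1
  have h3 : (√3 : ℝ) ≠ 0 := by positivity
  have hq : q = 0 := by
    have : q * (a * √3 / 2) = 0 := by simpa using e1
    simpa [ha, h3] using this
  have hp : p = 0 := by
    rw [hq] at e0
    have : p * a = 0 := by simpa using e0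
    simpa [ha] using this
  exact ⟨hp, hq⟩

/-- **Sign of the planar sums** (Banaszczyk): the Gaussian mass of a triangular layer seen from a
hole is at most that seen from a lattice point, `Φ_N(0) ≤ Φ_A(0)`. -/
theorem layerInteraction_one_zero_le {t a : ℝ} (ht : 0 < t) (ha : a ≠ 0) (h : ℝ) :
    layerInteraction (fun r => Real.exp (-t * r ^ 2)) a h 1 0 ≤
      layerInteraction (fun r => Real.exp (-t * r ^ 2)) a h 0 0 := by
  have key := Literature.Algebra.EuclideanLattices.tsum_exp_neg_mul_norm_zsmul_add_zsmul_sub_sq_le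
    (linearIndependent_triangularVec ha) ht (-barlowOffset a)
  have e1 : ∀ ij : ℤ × ℤ, (fun r => Real.exp (-t * r ^ 2)) ‖layerVec a h 1 0 ij.1 ij.2‖ =
      Real.exp (-t * ‖(ij.1 : ℝ) • triangularVec₁ a + (ij.2 : ℝ) • triangularVec₂ a -
        -barlowOffset a‖ ^ 2) := fun ij => by
    simp only [layerVec, sub_neg_eq_add, Int.cast_one, one_smul, Int.cast_zero, zero_smul, add_zero]
  have e0 : ∀ ij : ℤ × ℤ, (fun r => Real.exp (-t * r ^ 2)) ‖layerVec a h 0 0 ij.1 ij.2‖ =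
      Real.exp (-t * ‖(ij.1 : ℝ) • triangularVec₁ a + (ij.2 : ℝ) • triangularVec₂ a‖ ^ 2) :=
    fun ij => by simp only [layerVec_zero_zero]
  unfold layerInteraction
  rw [tsum_congr e1, tsum_congr e0]
  exact key

/-- The Gaussian interlayer couplings are non-negative. -/
theorem barlowCoupling_gauss_nonneg {t a : ℝ} (ht : 0 < t) (ha : a ≠ 0) (h : ℝ) (k : ℕ) :
    0 ≤ barlowCoupling (fun r => Real.exp (-t * r ^ 2)) a h k := by
  rw [barlowCoupling_gauss]
  exact mul_nonneg (Real.exp_pos _).le (sub_nonneg.2 (layerInteraction_one_zero_le ht ha h))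

/-- The Gaussian interlayer couplings are non-increasing in the layer distance. -/
theorem barlowCoupling_gauss_succ_le {t a : ℝ} (ht : 0 < t) (ha : a ≠ 0) (h : ℝ) (k : ℕ) :
    barlowCoupling (fun r => Real.exp (-t * r ^ 2)) a h (k + 1) ≤
      barlowCoupling (fun r => Real.exp (-t * r ^ 2)) a h k := by
  rw [barlowCoupling_gauss, barlowCoupling_gauss]
  refine mul_le_mul_of_nonneg_right (Real.exp_le_exp.2 ?_)
    (sub_nonneg.2 (layerInteraction_one_zero_le ht ha h))
  have hk : (0 : ℝ) ≤ k := Nat.cast_nonneg k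
  have hsq : ((k : ℝ) * h) ^ 2 ≤ (((k + 1 : ℕ) : ℝ) * h) ^ 2 := by
    push_cast
    nlinarith [mul_nonneg hk (sq_nonneg h), sq_nonneg h]
  exact mul_le_mul_of_nonpos_left hsq (by linarith)

/-- The Gaussian layer sums `k ↦ Φ_δ(k)` are summable over the layer distance (`t > 0`, `h ≠ 0`):
`Φ_δ(k) = e^{-t h² k²} Φ_δ(0)` is dominated by the geometric series `e^{-t h² k}`. -/
theorem summable_layerInteraction_gauss {t h : ℝ} (ht : 0 < t) (hh : h ≠ 0) (a : ℝ) (δ : ℤ) :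
    Summable fun k : ℕ => layerInteraction (fun r => Real.exp (-t * r ^ 2)) a h δ k := by
  have hh2 : 0 < h ^ 2 := lt_of_le_of_ne (sq_nonneg h) (Ne.symm (pow_ne_zero 2 hh))
  have hb : -(t * h ^ 2) < 0 := neg_neg_of_pos (mul_pos ht hh2)
  have hsq : Summable fun k : ℕ => Real.exp (-(t * h ^ 2) * (k : ℝ) ^ 2) :=
    Real.summable_exp_nat_mul_of_ge hb fun k => by exact_mod_cast Nat.le_self_pow two_ne_zero k
  have hS := hsq.mul_right (layerInteraction (fun r => Real.exp (-t * r ^ 2)) a h δ 0)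
  refine hS.congr fun k => ?_
  rw [layerInteraction_gauss t a h δ k, Int.cast_natCast]
  congr 2
  ring

/-! ## The domination -/

/-- Backward local energy of the alternating stacking: `∑'_{k ≥ 2 even} J_k` (companion of
`haggLocalEnergy_alternating`). -/
theorem haggBackwardLocalEnergy_alternating (J : ℕ → ℝ) (m : ℤ) :
    haggBackwardLocalEnergy J alternatingHagg m = ∑' k : ℕ, if 2 ≤ k ∧ Even k then J k else 0 := by
  unfold haggBackwardLocalEnergy
  refine tsum_congr fun k => ?_
  have hiff : (2 ≤ k ∧ HaggAligned alternatingHagg (m - k) k) ↔ (2 ≤ k ∧ Even k) :=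
    and_congr Iff.rfl (haggAligned_alternating_iff _ _)
  exact if_congr hiff rfl rfl

/-- **Gaussian site energies of Barlow stackings are maximal for hcp** (any spacings `a ≠ 0`,
`h ≠ 0`, any `t > 0`): for every Hägg word `s` and layer `m`,
`barlowSiteEnergy (r ↦ e^{-t r²}) a h s m ≤ barlowSiteEnergy (r ↦ e^{-t r²}) a h alternatingHagg 0`. -/
theorem barlowSiteEnergy_gauss_le_alternating {t a h : ℝ} (ht : 0 < t) (ha : a ≠ 0) (hh : h ≠ 0)
    {s : ℤ → ℤ} (hs : IsHaggSeq s) (m : ℤ) :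
    barlowSiteEnergy (fun r => Real.exp (-t * r ^ 2)) a h s m ≤
      barlowSiteEnergy (fun r => Real.exp (-t * r ^ 2)) a h alternatingHagg 0 := by
  have hA := summable_layerInteraction_gauss ht hh a 0
  have hN := summable_layerInteraction_gauss ht hh a 1
  rw [barlowSiteEnergy_eq _ a h hs hA hN m, barlowSiteEnergy_eq _ a h isHaggSeq_alternating hA hN 0]
  set J : ℕ → ℝ := barlowCoupling (fun r => Real.exp (-t * r ^ 2)) a h with hJdef
  have hJ : Summable J := hA.sub hN
  have hJ0 : ∀ k, 0 ≤ J k := fun k => barlowCoupling_gauss_nonneg ht ha h k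
  have hmono : ∀ k, J (k + 1) ≤ J k := fun k => barlowCoupling_gauss_succ_le ht ha h k
  have h1 : haggLocalEnergy J s m ≤ haggLocalEnergy J alternatingHagg 0 := by
    rw [haggLocalEnergy_alternating, haggLocalEnergy]
    exact tsum_ite_le_tsum_ite_even (fun k _ hk => not_haggAligned_succ hs m k hk) hJ0 hmono hJ
  have h2 : haggBackwardLocalEnergy J s m ≤ haggBackwardLocalEnergy J alternatingHagg 0 := by
    rw [haggBackwardLocalEnergy_alternating, haggBackwardLocalEnergy]
    exact tsum_ite_le_tsum_ite_even (fun k _ hk => not_haggAligned_sub_succ hs m k hk) hJ0 hmono hJ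
  linarith

/-- **`BarlowThetaDominance`** (route `HcpThetaUniversality`, item stmt-AtomisticToContinuum-5060):
for every `t > 0`, every Hägg sequence `s` and every layer `m`, the Gaussian site energy of the
Barlow stacking `barlowStacking 1 √(2/3) s` at layer `m` is at most that of hcp (`alternatingHagg`)
at layer `0`. -/
theorem barlowThetaDominance_proof :
    Summit.AtomisticToContinuum.Crystallization.Theses.HcpThetaUniversality.BarlowThetaDominance := by
  unfold Summit.AtomisticToContinuum.Crystallization.Theses.HcpThetaUniversality.BarlowThetaDominance
  intro t ht s hs m
  have hh : Real.sqrt (2 / 3) ≠ 0 := (Real.sqrt_pos.2 (by norm_num)).ne'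
  exact barlowSiteEnergy_gauss_le_alternating ht one_ne_zero hh hs m

end Summit.AtomisticToContinuum.Crystallization.Theorems.BarlowTheta
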